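/-
COR-CM (cell pub-hodgecm2) — RSCONJ («`RecordSystem.conj`», IDENT-LEMMA component (e) «SPACE by construction»; coordinator 04:22Z,
PLANNER-A RSCONJ TABLE HOME∕INBOX l.14934), row FRAME part 2 of 2 (`RecordSystemConjTwist`): §3 the twist intertwines the Galois actions (`twist_smul`), §3b `σ ↦ conj ∘ σ ∘ conj` on `Aut(ℂ ∕ τL)` (`conjAlgEquiv`, `twist_smul_conj`); part 1 = `RecordSystemConjFrame.lean`; split only for the 400-line lint.  Lead pen prover-pub-hodgecm2-mukey-p6-g1-0;
the frame∕level definitions `conjFrame ∕ conjGram ∕ formCongr_conjFrame ∕ conjLevel₀ ∕ smallLevelConjBack` are mukey-p2 g1's (desk skeleton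
`RecordSystemConjSkeleton.lean` 0b87d68512da3d2b) verbatim up to namespace.  KERNEL: small definitions by explicit formula + theorems; no instance,
no named fact, no notation, no `sorry`.  HC_CM is NOT proved; HELD — WORLD = C FINAL; this file discharges no END binder and claims nothing about (iv-c).
-/
import Summits.HodgeConjecture.CorCM.D2Bridge.BettiConjugateEmbedding
import Mathlib.NumberTheory.NumberField.CMField
import HarnessLib

/-!
# RSCONJ frame, part 2: the twist of points along `σ` intertwines the Galois actions

* §3 (any fields) `algEquivTwist` (`γ^σ = σ ∘ γ ∘ σ⁻¹`) and **`twist_smul`**: wb-1's twist of points along `σ` intertwines the LEFT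
  Galois actions, `twist (γ • P) = γ^σ • twist P`;
* §3b (`F = ℂ`, `σ = conj`): `restrictConj`, **`conjAlgEquiv τ σ = conj ∘ σ ∘ conj`** on `Aut(ℂ ∕ τL)`, `twist_smul_conj`.

References: Hartshorne II Ex. 2.7 ∕ 4.7 (Galois action and twist of points, through wb-1's `BettiConjugateEmbedding`);
[Milne2005ShimuraVarieties] §12 (conjugates of Shimura varieties).
-/

set_option autoImplicit false

noncomputable section

open CategoryTheory AlgebraicGeometry NumberField
open Literature.AlgebraicGeometry.Motives

universe u

namespace Summit.HodgeConjecture.CorCM.Model.RecordSystemConj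

/-! ## §3 placed first (no CM hypotheses): the twist intertwines the Galois actions -/

/-! ## (F3)(i) the twist intertwines the Galois actions -/

section TwistSmul

open Summit.HodgeConjecture.CorCM.D2Bridge

variable {L F : Type u} [Field L] [Field F] {ι ι' : L →+* F} {σ : F ≃+* F}

/-- The `σ`-conjugate `γ^σ := σ ∘ γ ∘ σ⁻¹` of an automorphism `γ` of `F` over `L` (via `ι`) is an automorphism of `F` over `L`
via `ι' = σ ∘ ι`. [folklore] -/
def algEquivTwist (h : ι' = σ.toRingHom.comp ι) (γ : letI := ι.toAlgebra; F ≃ₐ[L] F) :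
    letI := ι'.toAlgebra; F ≃ₐ[L] F :=
  let e : F ≃+* F := letI := ι.toAlgebra; (γ : F ≃+* F)
  have he : ∀ c : L, e (ι c) = ι c := fun c => by
    letI := ι.toAlgebra
    exact γ.commutes c
  letI := ι'.toAlgebra
  { σ.symm.trans (e.trans σ) with
    commutes' := fun c => by
      change σ (e (σ.symm (ι' c))) = ι' c
      rw [h, RingHom.comp_apply, RingEquiv.toRingHom_eq_coe, RingEquiv.coe_toRingHom, σ.symm_apply_apply, he] }

/-- `γ^σ x = σ (γ (σ⁻¹ x))`. [folklore] -/
theorem algEquivTwist_apply (h : ι' = σ.toRingHom.comp ι) (γ : letI := ι.toAlgebra; F ≃ₐ[L] F) (x : F) :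
    (letI := ι'.toAlgebra; algEquivTwist h γ x) = σ (letI := ι.toAlgebra; γ (σ.symm x)) := rfl

/-- **(F3)(i)** The twist of `F`-points along `σ` (wb-1's `twist`: `P ↦ Spec σ ≫ P`, `Y(F via ι) → Y(F via ι')`) intertwines the
LEFT Galois actions (`AlgPoints.instMulActionAlgEquiv`): `twist (γ • P) = γ^σ • twist P`.  For `F = ℂ`, `σ = conj`, `ι = τ̄`,
`ι' = τ`: complex conjugation of points carries the action of `γ ∈ Aut(ℂ/τ̄L)` to that of `conj ∘ γ ∘ conj ∈ Aut(ℂ/τL)`. [folklore] -/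
theorem twist_smul (h : ι' = σ.toRingHom.comp ι) {Y : SchemeOver L} (γ : letI := ι.toAlgebra; F ≃ₐ[L] F)
    (P : PointsAlong Y ι) :
    twist h (letI := ι.toAlgebra; γ • P) = (letI := ι'.toAlgebra; algEquivTwist h γ • twist h P) := by
  have hL : (twist h (letI := ι.toAlgebra; γ • P)).left =
      Spec.map (CommRingCat.ofHom σ.toRingHom) ≫
        (Spec.map (CommRingCat.ofHom (letI := ι.toAlgebra; (γ : F →+* F))) ≫ P.left) := rfl
  have hR : (letI := ι'.toAlgebra; algEquivTwist h γ • twist h P).left =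
      Spec.map (CommRingCat.ofHom (letI := ι'.toAlgebra; (algEquivTwist h γ : F →+* F))) ≫
        (Spec.map (CommRingCat.ofHom σ.toRingHom) ≫ P.left) := rfl
  have key : σ.toRingHom.comp (letI := ι.toAlgebra; (γ : F →+* F)) =
      (letI := ι'.toAlgebra; (algEquivTwist h γ : F →+* F)).comp σ.toRingHom :=
    RingHom.ext fun x => by
      change σ (letI := ι.toAlgebra; γ x) = σ (letI := ι.toAlgebra; γ (σ.symm (σ x)))
      rw [σ.symm_apply_apply]
  ext : 1
  rw [hL, hR, ← Category.assoc, ← Category.assoc, ← Spec.map_comp, ← Spec.map_comp,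
    ← CommRingCat.ofHom_comp, ← CommRingCat.ofHom_comp, key]

end TwistSmul


/-! ### §3b  `F = ℂ`, `σ = conj`: automorphisms of `ℂ` over `τ(L)` vs over `τ̄(L)` (CM: the same subgroup of `Aut ℂ`) -/

section ComplexConj

open Summit.HodgeConjecture.CorCM.D2Bridge

variable {L : Type} [Field L] [NumberField L] [IsCMField L] (τ : L →+* ℂ)

omit [NumberField L] [IsCMField L] in
/-- `τ = conj ∘ τ̄` (the equation along which wb-1's `twist` carries `τ̄`-points to `τ`-points). [folklore] -/
theorem eq_starRingAut_comp_conjEmb : τ = (starRingAut : ℂ ≃+* ℂ).toRingHom.comp (conjEmb τ) :=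
  RingHom.ext fun x => (star_star (τ x)).symm

/-- An automorphism of `ℂ` over `L` VIA `τ` is an automorphism of `ℂ` over `L` VIA `τ̄ = conj ∘ τ` — the SAME map (for a CM field,
`τ̄(x) = τ(c x)`, so `τ(L)` and `τ̄(L)` coincide as subfields of `ℂ`). [folklore] -/
def restrictConj (σ : letI := τ.toAlgebra; ℂ ≃ₐ[L] ℂ) : letI := (conjEmb τ).toAlgebra; ℂ ≃ₐ[L] ℂ :=
  let e : ℂ ≃+* ℂ := letI := τ.toAlgebra; (σ : ℂ ≃+* ℂ)
  have he : ∀ x : L, e (τ x) = τ x := fun x => by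
    letI := τ.toAlgebra
    exact σ.commutes x
  letI := (conjEmb τ).toAlgebra
  { e with
    commutes' := fun x => by
      change e (starRingEnd ℂ (τ x)) = starRingEnd ℂ (τ x)
      rw [← IsCMField.complexEmbedding_complexConj]
      exact he _ }

/-- `restrictConj τ σ` is `σ` as a map. [folklore] -/
theorem restrictConj_apply (σ : letI := τ.toAlgebra; ℂ ≃ₐ[L] ℂ) (z : ℂ) :
    (letI := (conjEmb τ).toAlgebra; restrictConj τ σ z) = (letI := τ.toAlgebra; σ z) := rfl

/-- **`σ ↦ conj ∘ σ ∘ conj` on `Aut(ℂ ∕ τL)`** (= `algEquivTwist` along `τ = conj ∘ τ̄` of `restrictConj τ σ`). [folklore] -/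
def conjAlgEquiv (σ : letI := τ.toAlgebra; ℂ ≃ₐ[L] ℂ) : letI := τ.toAlgebra; ℂ ≃ₐ[L] ℂ :=
  algEquivTwist (eq_starRingAut_comp_conjEmb τ) (restrictConj τ σ)

/-- `conjAlgEquiv τ σ z = conj (σ (conj z))`. [folklore] -/
theorem conjAlgEquiv_apply (σ : letI := τ.toAlgebra; ℂ ≃ₐ[L] ℂ) (z : ℂ) :
    (letI := τ.toAlgebra; conjAlgEquiv τ σ z) = starRingEnd ℂ (letI := τ.toAlgebra; σ (starRingEnd ℂ z)) := rfl

/-- `conj ∘ (conj ∘ σ ∘ conj) ∘ conj = σ`. [folklore] -/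
theorem conjAlgEquiv_conjAlgEquiv (σ : letI := τ.toAlgebra; ℂ ≃ₐ[L] ℂ) :
    conjAlgEquiv τ (conjAlgEquiv τ σ) = σ := by
  letI := τ.toAlgebra
  refine AlgEquiv.ext fun z => ?_
  rw [conjAlgEquiv_apply, conjAlgEquiv_apply, starRingEnd_self_apply, starRingEnd_self_apply]

/-- **(F3)(i) for complex conjugation**: on points of an `L`-scheme, the twist `Y(ℂ via τ̄) → Y(ℂ via τ)` carries the action of
`σ ∈ Aut(ℂ ∕ τ̄L) = Aut(ℂ ∕ τL)` to that of `conj ∘ σ ∘ conj`. [folklore] -/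
theorem twist_smul_conj {Y : SchemeOver L} (σ : letI := τ.toAlgebra; ℂ ≃ₐ[L] ℂ) (P : PointsAlong Y (conjEmb τ)) :
    twist (eq_starRingAut_comp_conjEmb τ) (letI := (conjEmb τ).toAlgebra; restrictConj τ σ • P) =
      (letI := τ.toAlgebra; conjAlgEquiv τ σ • twist (eq_starRingAut_comp_conjEmb τ) P) :=
  twist_smul _ _ _

end ComplexConj



end Summit.HodgeConjecture.CorCM.Model.RecordSystemConj

end
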